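import Literature.MathematicalPhysics.QuantumFieldTheory.Balaban1983to89.B3Ineq213ZeroBoxLines
import Literature.MathematicalPhysics.QuantumFieldTheory.Balaban1983to89.B3GkZeroBoxSeparated

/-!
# B3 (2.13) p. 426 — the line hypothesis (2.10) WITH ITS DIFFERENTIATION RULE discharged for the zero-field box line
# class with differentiated legs: scalar propagators `G_k(□,0)`, `D^η_μ G_k(□,0)`, `G_k(□,0) D^{η*}_ν`, `D^η_μ G_k(□,0) D^{η*}_ν`

T. Bałaban, *(Higgs)₂,₃ quantum fields in a finite volume. III. Renormalization*, Commun. Math. Phys. **88** (1983)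
411–445 [Balaban1983Higgs3], Sect. 2, pp. 424–427 [PDF 14–17] (journal page = PDF page + 410; held text
`paper:balaban1983-higgs-2-3-quantum-fields-finite-volume`).

statement-level skeleton of published theorems with citation tags; proofs where landed; nothing here is a claim about
the Yang–Mills mass gap

Cell `lit-balaban` (HOME `run/shared/lean/pub/lit-balaban/`), Phase-2 proof seat `lit-balaban-p03` gen 5, rows
**B3.Eq2.13-2.14** and **B3.Eq2.10** (owner r15).  THEOREMS plus definitions with bodies (`dlineK`, `DLineGraph`,
`dboxCounts`, `dboxAmp`); imports the undifferentiated class `B3Ineq213ZeroBoxLines` (this seat, file 3 of gen 5) and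
gen-4's `B3GkZeroBoxSeparated` (for the mixed second difference of the (2.6) pieces, `abs_pieceMixed_le`).  No new
`def … : Prop`; no existing declaration is modified.

## What is printed

p. 426 [PDF 16]: *"For the propagators G^η_{(j)} we apply the inequality |G^η_{(j)}(Ω, B̃; x, x′)| ≦
O(1)(L^jη)^{−d+2}e^{−δ₁(L^jη)^{−1}|x−x′|}, (2.10) and if the propagator is differentiated, then for each differentiation,
there is an additional factor (L^jη)^{−1} on the right side."*; p. 422 (2.1) and p. 427 (2.14): a differentiation acting
on a line lowers its dimension by one (`B3Ineq215.Counts.legExp`: `−(d−2)/2` per leg, `−1` per differentiation).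

## What this file adds to file 3 (`B3Ineq213ZeroBoxLines`)

File 3 discharged p19's line hypothesis `B3Ineq213.Amp.K_le` for graphs all of whose lines are UNDIFFERENTIATED scalar
propagators at zero field in a box.  Here every line `l` may in addition carry a lattice derivative at either leg:
`dSrc l, dTgt l : Option (Fin (d+1))` (direction of the forward η-difference `D^η_μ = η^{−1}(f(x+ηe_μ) − f(x))` acting
on the first / second argument; at zero field `U = 1`, so `D^η_{B̃,μ} = D^η_μ`).  The line kernel `dlineK` at scale
index `t` is the corresponding difference of the (2.6) piece `G^η_{(t)}(□,0)` of gen-4's `B3Ineq210ZeroBox.piece`,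
in the `η^d`-weighted kernel units of p19's `E` (`η^{−(d+1)}×`, and `η^{−1}×` per differentiation), set to `0` when a
position or its shifted neighbour leaves the box.  The counts `dboxCounts` record one differentiation of the endpoint per
differentiated leg (`diffOn`), so the line dimension is `a_l = 2 − (d+1) − #{differentiated legs of l}`
(`dboxCounts_lineDim`), and `K_le` is PROVED (`dlineK_le`) from the three zero-field box kernel theorems of the
lineage — value `B3Ineq210ZeroBox.abs_piece_le`, one difference `abs_pieceDiff_le` (the column difference by the
symmetry `piece_symm`), mixed difference `B3GkZeroBoxSeparated.abs_pieceMixed_le` — with ONE pair of constants on `d`,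
`L`, the window.  Hence p19's (2.13) / (1.33)-at-fixed-ordering hold for `dboxAmp` with NO line hypothesis
(`ineq213_dboxAmp`, `ineq213_sum_dboxAmp`, `bound133_dboxAmp`); `dlineK_none_none` is the compatibility with file 3, and
the witness is the one-line graph with BOTH legs differentiated (the shape of the graph (2.4)).

## Declared divergences / scope

As in file 3: `A = B̃ = 0`, `Ω = □` only; scalar lines only (no vector-field lines, no averaged legs (2.12)); the vertex
hypothesis (i) stays data (`VertexData`); the forward difference at a far face of the box (neighbour outside `□`) is set
to `0` (the Neumann box propagator of [B4] is only ever differenced inside `□` by the pieces' kernel theorems).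
-/

namespace Literature.MathematicalPhysics.QuantumFieldTheory.Balaban1983to89.B3Ineq213ZeroBoxDiffLines

open Finset
open Literature.MathematicalPhysics.QuantumFieldTheory.Balaban1983to89.B3Ineq215
open Literature.MathematicalPhysics.QuantumFieldTheory.Balaban1983to89.B3Ineq213
open Literature.MathematicalPhysics.QuantumFieldTheory.Balaban1983to89.B3Ineq210ZeroBox
open Literature.MathematicalPhysics.QuantumFieldTheory.Balaban1983to89.B3GkZeroBoxSeparated (abs_pieceMixed_le)
open Literature.MathematicalPhysics.QuantumFieldTheory.Balaban1983to89.B3Ineq213ZeroBoxLines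
open Literature.MathematicalPhysics.QuantumFieldTheory.Balaban1983to89.B4Reflection242 (boxDom mem_boxDom)
open Literature.MathematicalPhysics.QuantumFieldTheory.Balaban1983to89.B4ContourShift (supNorm supNorm_nonneg)
open Literature.MathematicalPhysics.QuantumFieldTheory.Balaban1983to89.B4Thm110ZeroBox (Nf bj sc bj_cast sc_pos
  sc_mul_bj Gfine_isSymm)

noncomputable section

variable {d : ℕ}

/-! ## §1 Plumbing: shifted positions, symmetry of the pieces, scale conversions -/

/-- the neighbour `x + e_μ` of a position. [folklore] -/
def shiftPos (x : Fin (d + 1) → ℕ) (μ : Fin (d + 1)) : Fin (d + 1) → ℕ := x + Pi.single μ 1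

/-- the fine site of the neighbour is the shifted fine site. [folklore] -/
private theorem toZ_shiftPos (x : Fin (d + 1) → ℕ) (μ : Fin (d + 1)) :
    toZ (shiftPos x μ) = toZ x + Pi.single μ 1 := by
  funext i
  unfold B3Ineq213ZeroBoxLines.toZ shiftPos
  simp only [Pi.add_apply, Pi.single_apply, Nat.cast_add, Nat.cast_ite, Nat.cast_one, Nat.cast_zero]

/-- the (2.6) pieces of the zero-field box propagator are symmetric kernels (`𝒢_j` is symmetric,
`B4Thm110ZeroBox.Gfine_isSymm`). [cite: Balaban1983Higgs3, (2.6) p.424] -/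
theorem piece_symm (ℓ k : ℕ) (M : Fin (d + 1) → ℕ) (t : ℕ) (a m2 : ℝ) (x y : ↥(boxDom (Nf ℓ k M))) :
    piece ℓ k M t a m2 x y = piece ℓ k M t a m2 y x := by
  unfold piece
  split_ifs
  · exact ((Gfine_isSymm ℓ k M 1 a m2).apply x y).symm
  · rw [Matrix.sub_apply, Matrix.sub_apply, (Gfine_isSymm ℓ k M (t + 1) a m2).apply x y,
      (Gfine_isSymm ℓ k M t a m2).apply x y]
  · rfl

/-- `L^tη = s_t^{−1}` for `t ≤ k` (`s_t = L^{k−t}`). [cite: Balaban1983Higgs3, (2.10) p.426] -/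
theorem bscale_eq_inv_sc {ℓ k t : ℕ} (ht : t ≤ k) : bscale ℓ k t = (sc ℓ k t)⁻¹ := by
  have hs := (sc_pos ℓ k t).ne'
  have hb : (0 : ℝ) < (bj ℓ t : ℝ) := by rw [bj_cast]; positivity
  have h := sc_mul_bj (ℓ := ℓ) ht
  unfold bscale
  rw [← bj_cast, show ((((ℓ + 1) ^ k : ℕ) : ℝ)) = ((ℓ : ℝ) + 1) ^ k by push_cast; ring, ← h]
  field_simp

/-- `η^{−(d+1)}·L^{−t(d+1)} = s_t^{d+1}` (`t ≤ k`). [cite: Balaban1983Higgs3, (2.10) p.426] -/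
theorem Lk_pow_mul_inv_bj_pow {ℓ k t : ℕ} (ht : t ≤ k) :
    ((((ℓ + 1) ^ k : ℕ) : ℝ)) ^ (d + 1) * ((((bj ℓ t : ℕ) : ℝ) ^ (d + 1))⁻¹) = sc ℓ k t ^ (d + 1) := by
  have hb : (0 : ℝ) < (bj ℓ t : ℝ) := by rw [bj_cast]; positivity
  have h := sc_mul_bj (ℓ := ℓ) ht
  rw [show ((((ℓ + 1) ^ k : ℕ) : ℝ)) = ((ℓ : ℝ) + 1) ^ k by push_cast; ring, ← h, mul_pow, mul_assoc,
    mul_inv_cancel₀ (pow_ne_zero _ hb.ne'), mul_one]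

/-- the scale factor of a line with `n` differentiations: `s^{d+1}·(s^{2−n})^{−1} = (s^{−1})^{2−(d+1)−n}` (`n ≤ 2`).
[cite: Balaban1983Higgs3, (2.10) p.426] -/
theorem sc_factor_eq {s : ℝ} (hs : 0 < s) (n : ℕ) (hn : n ≤ 2) (e : ℕ) :
    s ^ e * (s ^ (2 - n))⁻¹ = s⁻¹ ^ ((2 : ℝ) - (e : ℝ) - (n : ℝ)) := by
  have h1 : s⁻¹ ^ ((2 : ℝ) - (e : ℝ) - (n : ℝ)) = s ^ (((e + n : ℕ) : ℝ) - ((2 : ℕ) : ℝ)) := by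
    rw [Real.inv_rpow hs.le, ← Real.rpow_neg hs.le]
    congr 1
    push_cast
    ring
  rw [h1, Real.rpow_sub hs, Real.rpow_natCast, Real.rpow_natCast, pow_add]
  have h2 : s ^ (2 - n) * s ^ n = s ^ 2 := pow_sub_mul_pow s hn
  have hsn : s ^ n ≠ 0 := pow_ne_zero _ hs.ne'
  have hs2n : s ^ (2 - n) ≠ 0 := pow_ne_zero _ hs.ne'
  rw [← h2]
  field_simp

/-- the decay exponent: `δ·|x−x′|_∞/L^t = δ·(L^tη)^{−1}·(η|x−x′|_∞)` (`t ≤ k`). [cite: Balaban1983Higgs3, (2.10) p.426] -/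
theorem decay_exponent_eq {ℓ k t : ℕ} (ht : t ≤ k) (δ D : ℝ) :
    δ * D / ((bj ℓ t : ℕ) : ℝ) = δ * (bscale ℓ k t)⁻¹ * (D / (((ℓ + 1) ^ k : ℕ) : ℝ)) := by
  have hb : (0 : ℝ) < (bj ℓ t : ℝ) := by rw [bj_cast]; positivity
  have hs := (sc_pos ℓ k t).ne'
  have h := sc_mul_bj (ℓ := ℓ) ht
  rw [bscale_eq_inv_sc ht, inv_inv, show ((((ℓ + 1) ^ k : ℕ) : ℝ)) = ((ℓ : ℝ) + 1) ^ k by push_cast; ring, ← h]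
  field_simp

/-! ## §2 The line kernels with differentiated legs -/

/-- number of differentiations carried by a leg: `1` if a direction is attached, else `0`.
[cite: Balaban1983Higgs3, (2.1) p.422] -/
def nd (o : Option (Fin (d + 1))) : ℕ := if o.isSome then 1 else 0

/-- `nd ≤ 1`. [cite: Balaban1983Higgs3, (2.1) p.422] -/
theorem nd_le_one (o : Option (Fin (d + 1))) : nd o ≤ 1 := by
  unfold nd; split_ifs <;> omega

/-- **The line kernel of a scalar line at scale index `t` with optional derivatives at its two legs** (zero field, box
`□`, `η^d`-weighted kernel units): `η^{−(d+1)}·G^η_{(t)}(x,x′)`, `η^{−(d+1)}·(D^η_μ G^η_{(t)})(x,x′) =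
η^{−(d+1)}η^{−1}(G^η_{(t)}(x+ηe_μ,x′) − G^η_{(t)}(x,x′))`, the same in the second argument, or the mixed second difference;
`0` if a position involved is outside `□`. [cite: Balaban1983Higgs3, (2.10) p.426, (2.6) p.424] -/
def dlineK (ℓ k : ℕ) (M : Fin (d + 1) → ℕ) (a m2 : ℝ) :
    Option (Fin (d + 1)) → Option (Fin (d + 1)) → ℕ → (Fin (d + 1) → ℕ) → (Fin (d + 1) → ℕ) → ℝ
  | none, none => fun t x x' => lineK ℓ k M a m2 t x x'
  | some μ, none => fun t x x' =>
      if h : InBox (Nf ℓ k M) x ∧ InBox (Nf ℓ k M) (shiftPos x μ) ∧ InBox (Nf ℓ k M) x' then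
        ((((ℓ + 1) ^ k : ℕ) : ℝ)) ^ (d + 1) * (((((ℓ + 1) ^ k : ℕ) : ℝ))
          * (piece ℓ k M t a m2 (site (shiftPos x μ) h.2.1) (site x' h.2.2)
              - piece ℓ k M t a m2 (site x h.1) (site x' h.2.2)))
      else 0
  | none, some ν => fun t x x' =>
      if h : InBox (Nf ℓ k M) x ∧ InBox (Nf ℓ k M) x' ∧ InBox (Nf ℓ k M) (shiftPos x' ν) then
        ((((ℓ + 1) ^ k : ℕ) : ℝ)) ^ (d + 1) * (((((ℓ + 1) ^ k : ℕ) : ℝ))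
          * (piece ℓ k M t a m2 (site x h.1) (site (shiftPos x' ν) h.2.2)
              - piece ℓ k M t a m2 (site x h.1) (site x' h.2.1)))
      else 0
  | some μ, some ν => fun t x x' =>
      if h : (InBox (Nf ℓ k M) x ∧ InBox (Nf ℓ k M) (shiftPos x μ)) ∧
          (InBox (Nf ℓ k M) x' ∧ InBox (Nf ℓ k M) (shiftPos x' ν)) then
        ((((ℓ + 1) ^ k : ℕ) : ℝ)) ^ (d + 1) * (((((ℓ + 1) ^ k : ℕ) : ℝ)) ^ 2
          * ((piece ℓ k M t a m2 (site (shiftPos x μ) h.1.2) (site (shiftPos x' ν) h.2.2)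
              - piece ℓ k M t a m2 (site x h.1.1) (site (shiftPos x' ν) h.2.2))
            - (piece ℓ k M t a m2 (site (shiftPos x μ) h.1.2) (site x' h.2.1)
              - piece ℓ k M t a m2 (site x h.1.1) (site x' h.2.1))))
      else 0

/-- compatibility with file 3: no derivative = the undifferentiated line kernel `lineK`.
[cite: Balaban1983Higgs3, (2.10) p.426] -/
theorem dlineK_none_none (ℓ k : ℕ) (M : Fin (d + 1) → ℕ) (a m2 : ℝ) :
    dlineK ℓ k M a m2 none none = lineK ℓ k M a m2 := rfl

/-- the common shape of the right side of (2.10) with `n` differentiations: `C·(L^tη)^{2−(d+1)−n}·e^{−δ(L^tη)^{−1}η|x−x′|_∞}`.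
[cite: Balaban1983Higgs3, (2.10) p.426] -/
def rhs210 (ℓ k : ℕ) (δ C : ℝ) (n t : ℕ) (x x' : Fin (d + 1) → ℕ) : ℝ :=
  C * bscale ℓ k t ^ ((2 : ℝ) - ((d + 1 : ℕ) : ℝ) - (n : ℝ))
    * Real.exp (-(δ * (bscale ℓ k t)⁻¹ * ((supDist x x' : ℝ) / (((ℓ + 1) ^ k : ℕ) : ℝ))))

/-- the right side is non-negative for `C ≥ 0`. [cite: Balaban1983Higgs3, (2.10) p.426] -/
theorem rhs210_nonneg (ℓ k : ℕ) {δ C : ℝ} (hC : 0 ≤ C) (n t : ℕ) (x x' : Fin (d + 1) → ℕ) :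
    0 ≤ rhs210 ℓ k δ C n t x x' :=
  mul_nonneg (mul_nonneg hC (Real.rpow_pos_of_pos (bscale_pos ℓ k t) _).le) (Real.exp_pos _).le

/-- monotonicity of the right side in the constants: `C ≤ C′`, `δ′ ≤ δ`. [cite: Balaban1983Higgs3, (2.10) p.426] -/
theorem rhs210_mono (ℓ k : ℕ) {δ δ' C C' : ℝ} (hC : 0 ≤ C) (hCC : C ≤ C') (hδ : δ' ≤ δ) (n t : ℕ)
    (x x' : Fin (d + 1) → ℕ) : rhs210 ℓ k δ C n t x x' ≤ rhs210 ℓ k δ' C' n t x x' := by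
  unfold rhs210
  have hb := bscale_pos ℓ k t
  have hD : 0 ≤ (bscale ℓ k t)⁻¹ * ((supDist x x' : ℝ) / (((ℓ + 1) ^ k : ℕ) : ℝ)) := by positivity
  refine mul_le_mul (mul_le_mul_of_nonneg_right hCC (Real.rpow_pos_of_pos hb _).le) ?_ (Real.exp_pos _).le
    (mul_nonneg (hC.trans hCC) (Real.rpow_pos_of_pos hb _).le)
  rw [Real.exp_le_exp, neg_le_neg_iff, mul_assoc, mul_assoc]
  exact mul_le_mul_of_nonneg_right hδ hD

/-- conversion of a piece bound in the counting normalisation (`(L^{t(d+1)})^{−1}(s_t^{2−n})^{−1}e^{−δ|x−x′|_∞/L^t}`, as in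
`abs_piece_le` / `abs_pieceDiff_le` / `abs_pieceMixed_le`) to the shape `rhs210` after multiplication by `η^{−(d+1)}`.
[cite: Balaban1983Higgs3, (2.10) p.426] -/
theorem convert_bound {ℓ k t : ℕ} {M : Fin (d + 1) → ℕ} (ht : t ≤ k) {δ C V : ℝ} (n : ℕ)
    (hn : n ≤ 2) {x x' : Fin (d + 1) → ℕ} (hx : InBox (Nf ℓ k M) x) (hx' : InBox (Nf ℓ k M) x')
    (hV : V ≤ C * ((((bj ℓ t : ℕ) : ℝ) ^ (d + 1))⁻¹ * (sc ℓ k t ^ (2 - n))⁻¹)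
      * Real.exp (-(δ * supNorm ((site (N := Nf ℓ k M) x hx).1 - (site (N := Nf ℓ k M) x' hx').1)
          / ((bj ℓ t : ℕ) : ℝ)))) :
    ((((ℓ + 1) ^ k : ℕ) : ℝ)) ^ (d + 1) * V ≤ rhs210 ℓ k δ C n t x x' := by
  have hLk : (0 : ℝ) < ((((ℓ + 1) ^ k : ℕ) : ℝ)) ^ (d + 1) := by positivity
  have hdist : supNorm ((site (N := Nf ℓ k M) x hx).1 - (site (N := Nf ℓ k M) x' hx').1) = (supDist x x' : ℝ) :=
    supNorm_toZ_sub x x'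
  rw [hdist] at hV
  calc ((((ℓ + 1) ^ k : ℕ) : ℝ)) ^ (d + 1) * V
      ≤ ((((ℓ + 1) ^ k : ℕ) : ℝ)) ^ (d + 1) * (C * ((((bj ℓ t : ℕ) : ℝ) ^ (d + 1))⁻¹ * (sc ℓ k t ^ (2 - n))⁻¹)
          * Real.exp (-(δ * (supDist x x' : ℝ) / ((bj ℓ t : ℕ) : ℝ)))) := mul_le_mul_of_nonneg_left hV hLk.le
    _ = C * (((((ℓ + 1) ^ k : ℕ) : ℝ)) ^ (d + 1) * ((((bj ℓ t : ℕ) : ℝ) ^ (d + 1))⁻¹) * (sc ℓ k t ^ (2 - n))⁻¹)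
          * Real.exp (-(δ * (supDist x x' : ℝ) / ((bj ℓ t : ℕ) : ℝ))) := by ring
    _ = rhs210 ℓ k δ C n t x x' := by
          rw [Lk_pow_mul_inv_bj_pow ht, sc_factor_eq (sc_pos ℓ k t) n hn, ← bscale_eq_inv_sc ht,
            decay_exponent_eq ht, rhs210]

/-- **(2.10) with its differentiation rule for the line kernels, from the zero-field box kernel theorems of the lineage**:
there are `δ₁ > 0`, `C > 0` (on `d`, `L`, the window) with `|K(t; x, x′)| ≤ C (L^tη)^{2−(d+1)−n} e^{−δ₁(L^tη)^{−1}·η|x−x′|_∞}`,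
`n` = the number of differentiated legs, for every `k ≥ 1`, `t < k`, window point, box and all positions.
[cite: Balaban1983Higgs3, (2.10) p.426] -/
theorem exists_dlineK_le (d ℓ : ℕ) (hℓ : 1 ≤ ℓ) (amin aplus m2plus : ℝ) (ha : 0 < amin) :
    ∃ δ₁ C : ℝ, 0 < δ₁ ∧ 0 < C ∧ ∀ (k : ℕ), 1 ≤ k → ∀ (t : ℕ), t < k → ∀ (a m2 : ℝ), amin ≤ a → a ≤ aplus →
      0 ≤ m2 → m2 ≤ m2plus → ∀ (M : Fin (d + 1) → ℕ), (∀ i, 1 ≤ M i) →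
        ∀ (μo νo : Option (Fin (d + 1))) (x x' : Fin (d + 1) → ℕ),
          |dlineK ℓ k M a m2 μo νo t x x'| ≤ rhs210 ℓ k δ₁ C (nd μo + nd νo) t x x' := by
  obtain ⟨δa, Ca, hδa, hCa, hA⟩ := abs_piece_le d ℓ hℓ amin aplus m2plus ha
  obtain ⟨δb, Cb, hδb, hCb, hB⟩ := abs_pieceDiff_le d ℓ hℓ amin aplus m2plus ha
  obtain ⟨δc, Cc, hδc, hCc, hC⟩ := abs_pieceMixed_le d ℓ hℓ amin aplus m2plus ha
  set δ := min δa (min δb δc) with hδdef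
  set C := Ca + Cb + Cc with hCdef
  have hδ_a : δ ≤ δa := min_le_left _ _
  have hδ_b : δ ≤ δb := (min_le_right _ _).trans (min_le_left _ _)
  have hδ_c : δ ≤ δc := (min_le_right _ _).trans (min_le_right _ _)
  have hC_a : Ca ≤ C := by rw [hCdef]; linarith
  have hC_b : Cb ≤ C := by rw [hCdef]; linarith
  have hC_c : Cc ≤ C := by rw [hCdef]; linarith
  have hC0 : 0 < C := by rw [hCdef]; linarith
  refine ⟨δ, C, lt_min hδa (lt_min hδb hδc), hC0, ?_⟩
  intro k hk t ht a m2 h1 h2 h3 h4 M hM μo νo x x'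
  have htk : t ≤ k := ht.le
  have hLk1 : (0 : ℝ) ≤ ((((ℓ + 1) ^ k : ℕ) : ℝ)) := by positivity
  cases μo with
  | none =>
    cases νo with
    | none =>
      -- value clause
      show |lineK ℓ k M a m2 t x x'| ≤ rhs210 ℓ k δ C (0 + 0) t x x'
      by_cases hin : InBox (Nf ℓ k M) x ∧ InBox (Nf ℓ k M) x'
      · rw [lineK_of_inBox t hin.1 hin.2, abs_mul, abs_of_nonneg (pow_nonneg hLk1 _)]
        refine (convert_bound htk 0 (by omega) hin.1 hin.2 ?_).trans
          (rhs210_mono ℓ k hCa.le hC_a hδ_a _ t x x')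
        simpa only [pow_sub_mul_pow, Nat.sub_zero] using hA k hk t ht a m2 h1 h2 h3 h4 M hM (site x hin.1) (site x' hin.2)
      · rw [lineK_of_not_inBox t hin, abs_zero]
        exact rhs210_nonneg ℓ k hC0.le _ t x x'
    | some ν =>
      -- column difference, by symmetry a row difference at `x′`
      show |dite _ _ _| ≤ rhs210 ℓ k δ C (0 + 1) t x x'
      split_ifs with hin
      · rw [abs_mul, abs_of_nonneg (pow_nonneg hLk1 _), abs_mul, abs_of_nonneg hLk1]
        refine (convert_bound htk 1 (by omega) hin.1 hin.2.1 ?_).trans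
          (rhs210_mono ℓ k hCb.le hC_b hδ_b _ t x x')
        have h0 := hB k hk t ht a m2 h1 h2 h3 h4 M hM ν (site x' hin.2.1) (site (shiftPos x' ν) hin.2.2)
          (toZ_shiftPos x' ν) (site x hin.1)
        rw [piece_symm ℓ k M t a m2 (site x hin.1) (site (shiftPos x' ν) hin.2.2),
          piece_symm ℓ k M t a m2 (site x hin.1) (site x' hin.2.1)]
        have hn : supNorm ((site (N := Nf ℓ k M) x hin.1).1 - (site (N := Nf ℓ k M) x' hin.2.1).1)
            = supNorm ((site (N := Nf ℓ k M) x' hin.2.1).1 - (site (N := Nf ℓ k M) x hin.1).1) := by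
          show supNorm (toZ x - toZ x') = supNorm (toZ x' - toZ x)
          rw [supNorm_toZ_sub, supNorm_toZ_sub, supDist_comm]
        rw [hn, pow_one]
        exact h0
      · rw [abs_zero]
        exact rhs210_nonneg ℓ k hC0.le _ t x x'
  | some μ =>
    cases νo with
    | none =>
      -- row difference
      show |dite _ _ _| ≤ rhs210 ℓ k δ C (1 + 0) t x x'
      split_ifs with hin
      · rw [abs_mul, abs_of_nonneg (pow_nonneg hLk1 _), abs_mul, abs_of_nonneg hLk1]
        refine (convert_bound htk 1 (by omega) hin.1 hin.2.2 ?_).trans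
          (rhs210_mono ℓ k hCb.le hC_b hδ_b _ t x x')
        rw [pow_one]
        exact hB k hk t ht a m2 h1 h2 h3 h4 M hM μ (site x hin.1) (site (shiftPos x μ) hin.2.1)
          (toZ_shiftPos x μ) (site x' hin.2.2)
      · rw [abs_zero]
        exact rhs210_nonneg ℓ k hC0.le _ t x x'
    | some ν =>
      -- mixed second difference
      show |dite _ _ _| ≤ rhs210 ℓ k δ C (1 + 1) t x x'
      split_ifs with hin
      · rw [abs_mul, abs_of_nonneg (pow_nonneg hLk1 _), abs_mul, abs_of_nonneg (pow_nonneg hLk1 _)]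
        refine (convert_bound htk 2 le_rfl hin.1.1 hin.2.1 ?_).trans
          (rhs210_mono ℓ k hCc.le hC_c hδ_c _ t x x')
        have h0 := hC k hk t ht a m2 h1 h2 h3 h4 M hM μ ν (site x hin.1.1) (site (shiftPos x μ) hin.1.2)
          (toZ_shiftPos x μ) (site x' hin.2.1) (site (shiftPos x' ν) hin.2.2) (toZ_shiftPos x' ν)
        simpa only [Nat.sub_self, pow_zero, inv_one, mul_one] using h0
      · rw [abs_zero]
        exact rhs210_nonneg ℓ k hC0.le _ t x x'

/-- the decay rate `δ₁(d, L, window)` of `exists_dlineK_le`. [cite: Balaban1983Higgs3, (2.10) p.426] -/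
def ddelta1 (d ℓ : ℕ) (hℓ : 1 ≤ ℓ) (amin aplus m2plus : ℝ) (ha : 0 < amin) : ℝ :=
  (exists_dlineK_le d ℓ hℓ amin aplus m2plus ha).choose

/-- the constant `C(d, L, window)` of `exists_dlineK_le`. [cite: Balaban1983Higgs3, (2.10) p.426] -/
def dconst (d ℓ : ℕ) (hℓ : 1 ≤ ℓ) (amin aplus m2plus : ℝ) (ha : 0 < amin) : ℝ :=
  (exists_dlineK_le d ℓ hℓ amin aplus m2plus ha).choose_spec.choose

/-- `δ₁ > 0`. [cite: Balaban1983Higgs3, (2.10) p.426] -/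
theorem ddelta1_pos (d ℓ : ℕ) (hℓ : 1 ≤ ℓ) (amin aplus m2plus : ℝ) (ha : 0 < amin) :
    0 < ddelta1 d ℓ hℓ amin aplus m2plus ha :=
  (exists_dlineK_le d ℓ hℓ amin aplus m2plus ha).choose_spec.choose_spec.1

/-- `C > 0`. [cite: Balaban1983Higgs3, (2.10) p.426] -/
theorem dconst_pos (d ℓ : ℕ) (hℓ : 1 ≤ ℓ) (amin aplus m2plus : ℝ) (ha : 0 < amin) :
    0 < dconst d ℓ hℓ amin aplus m2plus ha :=
  (exists_dlineK_le d ℓ hℓ amin aplus m2plus ha).choose_spec.choose_spec.2.1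

/-- **(2.10) with its differentiation rule, chosen constants.** [cite: Balaban1983Higgs3, (2.10) p.426] -/
theorem dlineK_le (d ℓ : ℕ) (hℓ : 1 ≤ ℓ) (amin aplus m2plus : ℝ) (ha : 0 < amin) {k : ℕ} (hk : 1 ≤ k) {t : ℕ}
    (ht : t < k) {a m2 : ℝ} (h1 : amin ≤ a) (h2 : a ≤ aplus) (h3 : 0 ≤ m2) (h4 : m2 ≤ m2plus)
    {M : Fin (d + 1) → ℕ} (hM : ∀ i, 1 ≤ M i) (μo νo : Option (Fin (d + 1))) (x x' : Fin (d + 1) → ℕ) :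
    |dlineK ℓ k M a m2 μo νo t x x'|
      ≤ rhs210 ℓ k (ddelta1 d ℓ hℓ amin aplus m2plus ha) (dconst d ℓ hℓ amin aplus m2plus ha) (nd μo + nd νo) t x x' :=
  (exists_dlineK_le d ℓ hℓ amin aplus m2plus ha).choose_spec.choose_spec.2.2 k hk t ht a m2 h1 h2 h3 h4 M hM μo νo x x'

/-! ## §3 The graph side with differentiated legs -/

variable {V : Type} [Fintype V] [DecidableEq V] {m : ℕ}

/-- **A graph of the zero-field box line class with differentiated legs**: the data of `LineGraph` plus, per line, the
optional direction of a lattice derivative acting on its first / second leg. [cite: Balaban1983Higgs3, (2.1) p.422, (2.14) p.427] -/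
structure DLineGraph (V : Type) [Fintype V] [DecidableEq V] (m d : ℕ) extends LineGraph V m where
  /-- derivative at the first leg of `l(i+1)`, if any -/
  dSrc : Fin m → Option (Fin (d + 1))
  /-- derivative at the second leg of `l(i+1)`, if any -/
  dTgt : Fin m → Option (Fin (d + 1))

/-- **The counts of a graph with differentiated legs**: `diffOn v l` = the number of differentiated legs of `l` at `v`, no
averaged legs; dimension `d + 1`, `L = ℓ + 1`, rate `δ₁` of `exists_dlineK_le`. [cite: Balaban1983Higgs3, (2.14) p.427] -/
def dboxCounts (Γ : DLineGraph V m d) (ℓ : ℕ) (hℓ : 1 ≤ ℓ) (amin aplus m2plus : ℝ) (ha : 0 < amin) :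
    Counts V m where
  src := Γ.src
  tgt := Γ.tgt
  touches := Γ.touches
  diffOn := fun v l => (if Γ.src l = v then nd (Γ.dSrc l) else 0) + (if Γ.tgt l = v then nd (Γ.dTgt l) else 0)
  vecLegAvg := fun _ _ => 0
  etaPow := Γ.etaPow
  d := d + 1
  L := ℓ + 1
  δ₁ := ddelta1 d ℓ hℓ amin aplus m2plus ha
  d_pos := Nat.succ_pos d
  two_le_L := by omega
  δ₁_pos := ddelta1_pos d ℓ hℓ amin aplus m2plus ha

section CountsFacts

variable (Γ : DLineGraph V m d) (ℓ : ℕ) (hℓ : 1 ≤ ℓ) (amin aplus m2plus : ℝ) (ha : 0 < amin)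

/-- a line has two legs. [cite: Balaban1983Higgs3, (2.14) p.427] -/
theorem dsum_legsOn (l : Fin m) :
    ∑ v, ((dboxCounts Γ ℓ hℓ amin aplus m2plus ha).legsOn v l : ℝ) = 2 := by
  have h : ∀ v, ((dboxCounts Γ ℓ hℓ amin aplus m2plus ha).legsOn v l : ℝ)
      = (if Γ.src l = v then (1 : ℝ) else 0) + (if Γ.tgt l = v then (1 : ℝ) else 0) := by
    intro v
    unfold Counts.legsOn
    simp only [dboxCounts]
    push_cast
    rfl
  simp_rw [h]
  rw [Finset.sum_add_distrib, Finset.sum_ite_eq, Finset.sum_ite_eq]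
  simp only [Finset.mem_univ, if_true]
  norm_num

/-- the differentiations acting on a line: `Σ_v diffOn v l = nd(dSrc l) + nd(dTgt l)`. [cite: Balaban1983Higgs3, (2.14) p.427] -/
theorem dsum_diffOn (l : Fin m) :
    ∑ v, ((dboxCounts Γ ℓ hℓ amin aplus m2plus ha).diffOn v l : ℝ)
      = ((nd (Γ.dSrc l) + nd (Γ.dTgt l) : ℕ) : ℝ) := by
  have h : ∀ v, ((dboxCounts Γ ℓ hℓ amin aplus m2plus ha).diffOn v l : ℝ)
      = (if Γ.src l = v then (nd (Γ.dSrc l) : ℝ) else 0) + (if Γ.tgt l = v then (nd (Γ.dTgt l) : ℝ) else 0) := by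
    intro v
    simp only [dboxCounts]
    push_cast
    rfl
  simp_rw [h]
  rw [Finset.sum_add_distrib, Finset.sum_ite_eq, Finset.sum_ite_eq]
  simp only [Finset.mem_univ, if_true]
  push_cast
  ring

/-- **the line dimension with differentiated legs**: `a_l = 2 − (d+1) − #{differentiated legs of l}`.
[cite: Balaban1983Higgs3, (2.1) p.422, (2.14) p.427] -/
theorem dboxCounts_lineDim (l : Fin m) :
    (dboxCounts Γ ℓ hℓ amin aplus m2plus ha).lineDim l
      = (2 : ℝ) - ((d + 1 : ℕ) : ℝ) - ((nd (Γ.dSrc l) + nd (Γ.dTgt l) : ℕ) : ℝ) := by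
  have h2 := dsum_legsOn Γ ℓ hℓ amin aplus m2plus ha l
  have h3 := dsum_diffOn Γ ℓ hℓ amin aplus m2plus ha l
  unfold Counts.lineDim Counts.legExp
  rw [Finset.sum_add_distrib, Finset.sum_sub_distrib, ← Finset.mul_sum, h2, h3]
  simp only [dboxCounts, Nat.cast_zero, Finset.sum_const_zero, add_zero]
  push_cast
  ring

/-- the model's line dimension. [cite: Balaban1983Higgs3, (2.14) p.427] -/
theorem dtoModel_a (l : Fin m) :
    (dboxCounts Γ ℓ hℓ amin aplus m2plus ha).toModel.a l
      = (2 : ℝ) - ((d + 1 : ℕ) : ℝ) - ((nd (Γ.dSrc l) + nd (Γ.dTgt l) : ℕ) : ℝ) :=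
  dboxCounts_lineDim Γ ℓ hℓ amin aplus m2plus ha l

/-- the model's scale. [cite: Balaban1983Higgs3, (2.10) p.426] -/
theorem dtoModel_sc (k t : ℕ) : (dboxCounts Γ ℓ hℓ amin aplus m2plus ha).toModel.sc k t = bscale ℓ k t := by
  unfold Model.sc bscale
  simp only [Counts.toModel, dboxCounts]
  push_cast
  ring

/-- the model's `(L^k)`. [cite: Balaban1983Higgs3, (2.10) p.426] -/
theorem dtoModel_Lpow (k : ℕ) :
    (((dboxCounts Γ ℓ hℓ amin aplus m2plus ha).toModel.L : ℝ) ^ k) = (((ℓ + 1) ^ k : ℕ) : ℝ) := by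
  simp only [Counts.toModel, dboxCounts]
  push_cast
  ring

end CountsFacts

/-! ## §4 The amplitude with differentiated legs and its estimates -/

/-- **The localized lattice amplitude of a graph of the zero-field box line class with differentiated legs**: p19's `Amp`
over the model of `dboxCounts`, line kernels `dlineK … (dSrc l) (dTgt l)`, constants of `dlineK_le`; the line hypothesis
`K_le` ((2.10) with its differentiation rule) is DISCHARGED. [cite: Balaban1983Higgs3, (2.13) p.426, (2.10) p.426] -/
def dboxAmp (Γ : DLineGraph V m d) (ℓ : ℕ) (hℓ : 1 ≤ ℓ) (amin aplus m2plus : ℝ) (ha : 0 < amin) {k : ℕ}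
    (hk : 1 ≤ k) {a m2 : ℝ} (h1 : amin ≤ a) (h2 : a ≤ aplus) (h3 : 0 ≤ m2) (h4 : m2 ≤ m2plus)
    (M : Fin (d + 1) → ℕ) (hM : ∀ i, 1 ≤ M i) (box : V → Fin (d + 1) → ℕ)
    (P : VertexData V d ℓ k Γ.etaPow) : Amp (dboxCounts Γ ℓ hℓ amin aplus m2plus ha).toModel where
  k := k
  box := box
  u := P.u
  K := fun l t x x' => dlineK ℓ k M a m2 (Γ.dSrc l) (Γ.dTgt l) t x x'
  C := fun _ => dconst d ℓ hℓ amin aplus m2plus ha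
  eRun := P.eRun
  lamRun := P.lamRun
  dv := P.dv
  ds := P.ds
  NPhi := P.NPhi
  NA := P.NA
  C_nonneg := fun _ => (dconst_pos d ℓ hℓ amin aplus m2plus ha).le
  eRun_nonneg := P.eRun_nonneg
  lamRun_nonneg := P.lamRun_nonneg
  NPhi_nonneg := P.NPhi_nonneg
  NA_nonneg := P.NA_nonneg
  e_nonneg := fun v => Nat.cast_nonneg _
  conn := Γ.conn
  u_le := fun v x => P.u_le v x
  K_le := fun l t ht x x' => by
    have h := dlineK_le d ℓ hℓ amin aplus m2plus ha hk ht h1 h2 h3 h4 hM (Γ.dSrc l) (Γ.dTgt l) x x'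
    have hδ : (dboxCounts Γ ℓ hℓ amin aplus m2plus ha).toModel.δ₀
        = ddelta1 d ℓ hℓ amin aplus m2plus ha / 2 := rfl
    have hexp : Real.exp (-(2 * (ddelta1 d ℓ hℓ amin aplus m2plus ha / 2) / bscale ℓ k t
        * ((((dboxCounts Γ ℓ hℓ amin aplus m2plus ha).toModel.L : ℝ) ^ k)⁻¹ * (supDist x x' : ℝ))))
        = Real.exp (-(ddelta1 d ℓ hℓ amin aplus m2plus ha * (bscale ℓ k t)⁻¹
            * ((supDist x x' : ℝ) / (((ℓ + 1) ^ k : ℕ) : ℝ)))) := by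
      congr 1
      rw [dtoModel_Lpow]
      ring
    rw [dtoModel_a, dtoModel_sc, hδ, hexp]
    exact h

section AmpFacts

variable (Γ : DLineGraph V m d) (ℓ : ℕ) (hℓ : 1 ≤ ℓ) (amin aplus m2plus : ℝ) (ha : 0 < amin) {k : ℕ} (hk : 1 ≤ k)
  {a m2 : ℝ} (h1 : amin ≤ a) (h2 : a ≤ aplus) (h3 : 0 ≤ m2) (h4 : m2 ≤ m2plus) (M : Fin (d + 1) → ℕ)
  (hM : ∀ i, 1 ≤ M i) (box : V → Fin (d + 1) → ℕ) (P : VertexData V d ℓ k Γ.etaPow)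

/-- the lines of `dboxAmp`. [cite: Balaban1983Higgs3, (2.10) p.426] -/
theorem dboxAmp_K (l : Fin m) (t : ℕ) (x x' : Fin (d + 1) → ℕ) :
    (dboxAmp Γ ℓ hℓ amin aplus m2plus ha hk h1 h2 h3 h4 M hM box P).K l t x x'
      = dlineK ℓ k M a m2 (Γ.dSrc l) (Γ.dTgt l) t x x' := rfl

/-- **(2.13) for the zero-field box line class with differentiated legs, NO line hypothesis.**
[cite: Balaban1983Higgs3, (2.13) p.426] -/
theorem ineq213_dboxAmp {j : Fin m → ℕ} (hj : j ∈ Model.Mon m k) :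
    B3Sect2FirstEstimate.Ineq213
      ((dboxCounts Γ ℓ hℓ amin aplus m2plus ha).toScaledGraph k j box)
      (∏ _l : Fin m, dconst d ℓ hℓ amin aplus m2plus ha) {j}
      (dboxAmp Γ ℓ hℓ amin aplus m2plus ha hk h1 h2 h3 h4 M hM box P).E P.eRun P.lamRun (∑ v, P.dv v)
      (∑ v, P.ds v) (boxTreeLen (ℓ + 1) k box) (∏ v, P.NPhi v) (∏ v, P.NA v) :=
  (dboxAmp Γ ℓ hℓ amin aplus m2plus ha hk h1 h2 h3 h4 M hM box P).ineq213 hj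

/-- **(2.13) summed over `J(l̃)`, differentiated legs.** [cite: Balaban1983Higgs3, (2.13) p.426] -/
theorem ineq213_sum_dboxAmp :
    |∑ j ∈ Model.Mon m k, (dboxAmp Γ ℓ hℓ amin aplus m2plus ha hk h1 h2 h3 h4 M hM box P).E j|
      ≤ (∏ _l : Fin m, dconst d ℓ hℓ amin aplus m2plus ha)
        * (P.eRun ^ (∑ v, P.dv v) * P.lamRun ^ (∑ v, P.ds v)
            * Real.exp (-(ddelta1 d ℓ hℓ amin aplus m2plus ha / 2 * boxTreeLen (ℓ + 1) k box))
            * (∏ v, P.NPhi v) * ∏ v, P.NA v)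
        * ∑ j ∈ Model.Mon m k, ((dboxCounts Γ ℓ hℓ amin aplus m2plus ha).toScaledGraph k j box).Etilde j :=
  (dboxAmp Γ ℓ hℓ amin aplus m2plus ha hk h1 h2 h3 h4 M hM box P).ineq213_sum

/-- **(1.33) at a fixed ordering for the class with differentiated legs, NO line hypothesis** (given Proposition 2.2's
positivity of the subgraph degrees). [cite: Balaban1983Higgs3, (1.33) p.420, (2.13) p.426, Prop. 2.2 p.428] -/
theorem bound133_dboxAmp
    (hpos : ∀ i, i ≤ m → ∀ b ∈ (dboxCounts Γ ℓ hℓ amin aplus m2plus ha).toModel.reps i,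
      (dboxCounts Γ ℓ hℓ amin aplus m2plus ha).toModel.Nontriv i b →
        0 < (dboxCounts Γ ℓ hℓ amin aplus m2plus ha).toModel.D i b) :
    |∑ j ∈ Model.Mon m k, (dboxAmp Γ ℓ hℓ amin aplus m2plus ha hk h1 h2 h3 h4 M hM box P).E j|
      ≤ (∏ _l : Fin m, dconst d ℓ hℓ amin aplus m2plus ha)
        * (dboxCounts Γ ℓ hℓ amin aplus m2plus ha).toModel.const215
        * (P.eRun ^ (∑ v, P.dv v) * P.lamRun ^ (∑ v, P.ds v)
            * Real.exp (-(ddelta1 d ℓ hℓ amin aplus m2plus ha / 2 * boxTreeLen (ℓ + 1) k box))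
            * (∏ v, P.NPhi v) * ∏ v, P.NA v) :=
  (dboxAmp Γ ℓ hℓ amin aplus m2plus ha hk h1 h2 h3 h4 M hM box P).bound133 hpos

end AmpFacts

/-! ## §5 Witness: the one-line graph with both legs differentiated (the shape of the graph (2.4)) -/

/-- the one-line graph on two vertices, its line differentiated at both legs (directions `0`, `0`) — the shape of (2.4).
[cite: Balaban1983Higgs3, (2.4) p.424] -/
def graph24Shape (d : ℕ) : DLineGraph (Fin 2) 1 d where
  toLineGraph := twoVertexGraph
  dSrc := fun _ => some 0
  dTgt := fun _ => some 0

/-- **Witness**: the amplitude of the one-line graph with both legs differentiated, in `d + 1 = 3`, `L = 2`, `k = 1`,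
`□ = [0,1)³`, `a = 1`, `m² = 0`, is a member of p19's class whose line kernel is the mixed second difference of the box
propagator pieces, with line dimension `2 − 3 − 2 = −3`. [cite: Balaban1983Higgs3, (2.13) p.426] -/
theorem dboxAmp_witness :
    ∃ A : Amp (dboxCounts (graph24Shape 2) 1 le_rfl (1 / 2) 2 1 (by norm_num)).toModel,
      A.k = 1 ∧ (dboxCounts (graph24Shape 2) 1 le_rfl (1 / 2) 2 1 (by norm_num)).toModel.a 0 = -3 ∧
      ∀ (t : ℕ) (x x' : Fin 3 → ℕ), A.K 0 t x x' = dlineK 1 1 (fun _ => 1) 1 0 (some 0) (some 0) t x x' := by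
  refine ⟨dboxAmp (graph24Shape 2) 1 le_rfl (1 / 2) 2 1 (by norm_num) (k := 1) le_rfl (a := 1) (m2 := 0)
    (by norm_num) (by norm_num) le_rfl (by norm_num) (fun _ => 1) (fun _ => le_rfl) (fun _ _ => 0)
    (zeroVertexData (Fin 2) 2 1 1 _), rfl, ?_, fun _ _ _ => rfl⟩
  rw [dtoModel_a]
  simp [nd, graph24Shape]

end

end Literature.MathematicalPhysics.QuantumFieldTheory.Balaban1983to89.B3Ineq213ZeroBoxDiffLines
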